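import Mathlib
import HarnessLib
import Summits.ValiantsHypothesis.ValiantsHypothesis.Theses.MonotoneRestoration
import Literature.Computability.AlgebraicComplexity.ArithCircuit
import Literature.Computability.AlgebraicComplexity.ArithCircuitProofs
import Literature.Computability.AlgebraicComplexity.MonotoneStructure
import Literature.Computability.AlgebraicComplexity.PermanentIrreducible
import Literature.ModelTheory.FiniteModelTheory.CkEquiv
import Summits.ValiantsHypothesis.ValiantsHypothesis.Theorems.MonotoneRestorationMonotoneRestorationQPCosetCount
import Summits.ValiantsHypothesis.ValiantsHypothesis.Theorems.MonotoneRestorationMonotoneRestorationQPSymmetricLB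
import Summits.ValiantsHypothesis.ValiantsHypothesis.Theorems.MonotoneRestorationMonotoneRestorationQPSupportSymmetrisation
import Summits.ValiantsHypothesis.ValiantsHypothesis.Theorems.MonotoneRestorationMonotoneRestorationQPSparseRegime
import Summits.ValiantsHypothesis.ValiantsHypothesis.Theorems.MonotoneRestorationMonotoneRestorationQPBeta
import Literature.Computability.AlgebraicComplexity.SymmetricArithCircuit
import Literature.Computability.AlgebraicComplexity.DawarWilsenach2025Proofs
import Literature.GroupTheory.PermutationGroups.SmallIndexSubgroups
import Summits.ValiantsHypothesis.ValiantsHypothesis.Theorems.MonotoneRestorationQP.Negative.LoadBearing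
import Summits.ValiantsHypothesis.ValiantsHypothesis.Theorems.MonotoneRestorationMonotoneRestorationQPPermSupportCount

/-! TTRL-lite variant V19309 of stmt-ValiantsHypothesis-15886 -/

set_option linter.dupNamespace false

namespace Summit.ValiantsHypothesis.ValiantsHypothesis.Theorems

open Summit.ValiantsHypothesis.ValiantsHypothesis.Theses.MonotoneRestoration
open Literature.Computability.AlgebraicComplexity

/-- TTRL-lite variant V19309 (assembly arithmetic, pure `ℕ`) of the registered stub
`stub_gammaArithmetic` of `stmt-ValiantsHypothesis-15886`: once `γ ≥ 3`, `n ≥ 24` and `2 γ² ≤ n`,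
the four non-binomial side conditions of the `γ`-regime hold: `8 < n`, `4 γ ≤ n`, `γ² ≤ n / 2` and
`n / 2 + γ + 9 ≤ n`.  The bound `n ≥ 24` is needed only for `γ = 3` (then `n / 2 + 12 ≤ n`); for
`γ ≥ 4` one uses `4 γ ≤ γ²`, so `⌈n/2⌉ ≥ γ² ≥ 4 γ ≥ γ + 9`.  Linear arithmetic after recording
`3 γ ≤ γ²` and `γ = 3 ∨ 4 γ ≤ γ²` (the product `γ * γ` is an `omega` atom). -/
theorem stub_gammaArithmetic_var19309 :
    ∀ (n γ : ℕ), 3 ≤ γ → 24 ≤ n → 2 * γ ^ 2 ≤ n →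
      8 < n ∧ 4 * γ ≤ n ∧ γ * γ ≤ n / 2 ∧ n / 2 + γ + 9 ≤ n := by
  intro n γ h3 h24 h2
  rw [sq] at h2
  have h9 : 3 * γ ≤ γ * γ := Nat.mul_le_mul_right γ h3
  have hkey : γ = 3 ∨ 4 * γ ≤ γ * γ := by
    rcases Nat.lt_or_ge γ 4 with hlt | hge
    · exact Or.inl (by omega)
    · exact Or.inr (Nat.mul_le_mul_right γ hge)
  generalize γ * γ = m at h2 h9 hkey ⊢
  omega

end Summit.ValiantsHypothesis.ValiantsHypothesis.Theorems
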